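import Summits.NavierStokesRegularity.NavierStokesRegularity.Theorems.CertifiedBlowupCertifiedBlowupAxisymBlowupSwirlEssential
import Summits.NavierStokesRegularity.NavierStokesRegularity.Theorems.SwirlThresholdSwirlSupStrictDecrease
import Literature.Analysis.FluidPDE.KNSSNoAxisymmetricTypeIHolds

/-!
# Witnesses of the crux `CertifiedBlowupAxisymBlowup` (stmt-NavierStokesRegularity-0727): the swirl
# persists up to the singular time, its supremum is strictly decreasing, and the blow-up is Type II

Theorems file landed `--supports stmt-NavierStokesRegularity-0727`, line `compact-amplification`
(continuation lead c2; bet route `SwirlThreshold`, where the crux is the decl `AxisymBlowup`,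
`Iff.rfl`-identical with `CertifiedBlowup.CertifiedBlowupAxisymBlowup`). The crux asks for a
viscosity `ν > 0`, a time `T > 0` and a maximal smooth solution `(u, p)` of lifespan `T`,
Leray–Hopf on `[0, T]` from its rapidly decaying axisymmetric datum `u 0`. Its informal text lists
"constraints any construction must respect"; this file turns them into kernel-checked theorems about
an arbitrary witness `(ν, T, u, p)`, using only PROVED theorems of the tree:

* `isAxisymmetric_slice_of_lerayHopf_classical`: every slice `u t`, `t ∈ [0, T)`, is axisymmetric
  (rotation covariance + Prodi–Serrin, `SwirlSupStrictDecrease.regular_of_classical_lerayHopf`);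
* `hasSmoothExtensionPast_of_hasNoSwirl_slice` / `not_hasNoSwirl_slice_of_isMaximalSmoothSolution`:
  **the swirl `Γ = r u_θ` of a witness vanishes identically at NO time `t ∈ [0, T)`** — if it did
  at `t₀`, the restart datum `u t₀` (smooth, `H^∞`, axisymmetric, swirl-free) would launch global
  Tao-class solutions (ns.S24 in Tao's class, `exists_isTaoSolutionOn_of_noSwirl` with the
  discharged `tao2011_smooth_local_existence_holds` and Ladyzhenskaya's a-priori bound
  `axisymmetricNoSwirl_enstrophy_apriori_holds`), which glue (`IsTaoSolutionOn.glue`) to the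
  Tao-class development of `u 0` and continue `u` past `T` by weak–strong uniqueness
  (`amplificationOf_tao_eq`). This sharpens the landed `not_hasNoSwirl_of_isMaximalSmoothSolution`
  (datum only) to every time before blow-up: "the swirl cannot be used up before the singularity";
* `swirlSup_strictAnti_of_isMaximalSmoothSolution`: hence, by the route's proved support
  `SwirlSupStrictDecrease_proof` (stmt-2004), along every witness `t ↦ sup_x |Γ(t, x)|` is STRICTLY
  decreasing on the whole of `[0, T)` — the threshold structure (T1) of route `SwirlThreshold`, now
  unconditional for witnesses;
* `hasSmoothExtensionPast_of_typeI_or_axisBound` / `not_isTypeIBlowup_of_isMaximalSmoothSolution` /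
  `not_axisBound_of_isMaximalSmoothSolution`: **every witness is Type II and violates `r|u| ≤ C`**
  (KNSS 2009 Thms 6.1–6.2 / Seregin–Šverák 2009 Thm 1.1, discharged in the tree as
  `knss_no_axisymmetric_typeI_holds`; its sub-slab boundedness and axisymmetry hypotheses are
  supplied by `regular_of_classical_lerayHopf`) — the barrier
  `Literature.Barriers.NavierStokesRegularity.AxisymmetricTypeIExclusion` applied to the crux;
* `certifiedBlowupAxisymBlowup_iff_exists_typeII_swirling` (and the `SwirlThreshold.AxisymBlowup`
  form `axisymBlowup_iff_exists_typeII_swirling`): the crux is equivalent to its strengthening by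
  all of the above clauses.

No new definitions, no named-fact hypotheses, no `sorry`.

## References

* G. Koch, N. Nadirashvili, G. Seregin, V. Šverák, Acta Math. 203 (2009), Thms 6.1–6.2.
* G. Seregin, V. Šverák, Comm. PDE 34 (2009), Thm. 1.1.
* P. G. Lemarié-Rieusset, *The Navier–Stokes Problem in the 21st Century*, CRC 2016, Thm. 10.4.
* T. Tao, Anal. PDE 6 (2013) = arXiv:1108.1165, Thm. 5.4.
* Z. Lei, Q. S. Zhang, Pacific J. Math. 289 (2017), (1.4); KNSS 2009, Lemma 2.1.
-/

-- the summit and its single problem share the name (D-0017 nested layout)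
set_option linter.dupNamespace false

noncomputable section

open MeasureTheory Set Function Filter Topology Metric
open scoped ENNReal NNReal ContDiff

namespace Summit.NavierStokesRegularity.NavierStokesRegularity.Theorems.CertifiedBlowupAxisymBlowup.CompactAmplification

open Literature.Analysis.FluidPDE
open Summit.NavierStokesRegularity.NavierStokesRegularity.Theses.CertifiedBlowup
open Summit.NavierStokesRegularity.NavierStokesRegularity.Theorems.SwirlSupStrictDecrease

section Witness

variable {ν T : ℝ} {u : ℝ → (EuclideanSpace ℝ (Fin 3)) → (EuclideanSpace ℝ (Fin 3))} {p : ℝ → (EuclideanSpace ℝ (Fin 3)) → ℝ}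

/-! ### Axisymmetry and boundedness before the lifespan -/

/-- **Every slice of a classical Leray–Hopf solution from a rapidly decaying axisymmetric datum is
axisymmetric** on `[0, T)` (rotation covariance and Prodi–Serrin weak–strong uniqueness on the
closed sub-slabs `[0, t]`, `regular_of_classical_lerayHopf`). [folklore] -/
theorem isAxisymmetric_slice_of_lerayHopf_classical (hν : 0 < ν)
    (hcl : IsClassicalNSSolutionOn (Ico 0 T) ν 0 u p) (hLH : IsLerayHopfOn T ν 0 (u 0) u)
    (hdec : HasRapidSpatialDecay (u 0)) (haxi : IsAxisymmetric (u 0)) :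
    ∀ t ∈ Ico 0 T, IsAxisymmetric (u t) := by
  intro t ht
  rcases eq_or_lt_of_le ht.1 with h | h
  · rw [← h]; exact haxi
  · exact (regular_of_classical_lerayHopf hν hcl hLH hdec haxi h ht.2).2.2 t ⟨ht.1, le_rfl⟩

/-- **Pointwise boundedness on every earlier slab** `[0, T'] × ℝ³`, `T' < T` (Tao 2013 Cor. 11.1
with the Leray–Hopf energy bound and `H² ⊂ C_B`, packaged in `regular_of_classical_lerayHopf`; for
`T' ≤ 0` the slab is the datum, bounded by its decay constant). This is the hypothesis `hbdd` of the
tree's `knss_no_axisymmetric_typeI`. [folklore] -/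
theorem bounded_before_of_lerayHopf_classical (hν : 0 < ν)
    (hcl : IsClassicalNSSolutionOn (Ico 0 T) ν 0 u p) (hLH : IsLerayHopfOn T ν 0 (u 0) u)
    (hdec : HasRapidSpatialDecay (u 0)) (haxi : IsAxisymmetric (u 0)) :
    ∀ T' < T, ∃ M : ℝ, ∀ t ∈ Icc 0 T', ∀ x, ‖u t x‖ ≤ M := by
  intro T' hT'
  rcases lt_or_ge 0 T' with h | h
  · obtain ⟨-, ⟨V, -, hV⟩, -⟩ := regular_of_classical_lerayHopf hν hcl hLH hdec haxi h hT'
    exact ⟨V, hV⟩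
  · obtain ⟨C, hC⟩ := hdec 0 0
    refine ⟨C, fun t ht x => ?_⟩
    have ht0 : t = 0 := le_antisymm (ht.2.trans h) ht.1
    have h1 := hC x
    rw [pow_zero, one_mul, norm_iteratedFDeriv_zero] at h1
    rw [ht0]
    exact h1

/-! ### Type II necessity (KNSS 2009 / Seregin–Šverák 2009, discharged in the tree) -/

/-- **No axisymmetric Type I blow-up, for the crux's class of solutions.** A classical Leray–Hopf
solution on `[0, T)` from a rapidly decaying axisymmetric datum which obeys either the Type I bound
`|u| ≤ C/√(T - t)` near `T` (`IsTypeIBlowup u T`) or the axis bound `r|u| ≤ C` on `[0, T) × ℝ³`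
extends as a classical solution past `T`: the tree theorem `knss_no_axisymmetric_typeI_holds`
(KNSS 2009 Thms 6.1–6.2, Seregin–Šverák 2009 Thm 1.1), whose boundedness and axisymmetry
hypotheses on the sub-slabs are discharged by the two lemmas above.
[cite: KochNadirashviliSereginSverak2009, Thms 6.1–6.2] -/
theorem hasSmoothExtensionPast_of_typeI_or_axisBound (hν : 0 < ν) (hT : 0 < T)
    (hcl : IsClassicalNSSolutionOn (Ico 0 T) ν 0 u p) (hLH : IsLerayHopfOn T ν 0 (u 0) u)
    (hdec : HasRapidSpatialDecay (u 0)) (haxi : IsAxisymmetric (u 0))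
    (h : IsTypeIBlowup u T ∨ ∃ C : ℝ, ∀ t ∈ Ico 0 T, ∀ x, cylRadius x * ‖u t x‖ ≤ C) :
    HasSmoothExtensionPast ν 0 u T :=
  knss_no_axisymmetric_typeI_holds hν hT hcl hLH
    (bounded_before_of_lerayHopf_classical hν hcl hLH hdec haxi)
    (isAxisymmetric_slice_of_lerayHopf_classical hν hcl hLH hdec haxi) h

/-- **Every witness of the crux is of Type II**: a maximal Leray–Hopf classical solution of finite
lifespan `T` from a rapidly decaying axisymmetric datum does not obey `|u| ≤ C/√(T - t)` near `T`
for any `C`. [cite: KochNadirashviliSereginSverak2009, Thms 6.1–6.2] -/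
theorem not_isTypeIBlowup_of_isMaximalSmoothSolution (hν : 0 < ν) (hT : 0 < T)
    (hmax : IsMaximalSmoothSolution ν 0 u p T) (hLH : IsLerayHopfOn T ν 0 (u 0) u)
    (hdec : HasRapidSpatialDecay (u 0)) (haxi : IsAxisymmetric (u 0)) : ¬ IsTypeIBlowup u T :=
  fun hI => hmax.2 (hasSmoothExtensionPast_of_typeI_or_axisBound hν hT hmax.1 hLH hdec haxi (Or.inl hI))

/-- **Every witness of the crux violates the axis bound `r|u| ≤ C`** on `[0, T) × ℝ³`, for every
`C` (KNSS 2009 Thm 6.1). [cite: KochNadirashviliSereginSverak2009, Thm 6.1] -/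
theorem not_axisBound_of_isMaximalSmoothSolution (hν : 0 < ν) (hT : 0 < T)
    (hmax : IsMaximalSmoothSolution ν 0 u p T) (hLH : IsLerayHopfOn T ν 0 (u 0) u)
    (hdec : HasRapidSpatialDecay (u 0)) (haxi : IsAxisymmetric (u 0)) :
    ¬ ∃ C : ℝ, ∀ t ∈ Ico 0 T, ∀ x, cylRadius x * ‖u t x‖ ≤ C :=
  fun hC => hmax.2 (hasSmoothExtensionPast_of_typeI_or_axisBound hν hT hmax.1 hLH hdec haxi (Or.inr hC))

/-! ### The swirl persists up to the singular time -/

/-- **Tao-class developments of a classical Leray–Hopf solution below `T`** (no maximality needed):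
for `0 < t < T` the datum `u 0` has a Tao-class solution `(U, P)` on `[0, t]` with `U = u` there.
The solution is the Kato solution from its datum (`isKatoSolutionOn_of_classical`), Kato solutions
upgrade to Tao's class on closed sub-slabs (`exists_isTaoSolutionOn_of_isKatoSolutionOn`), and the
two agree by Prodi–Serrin (`amplificationOf_tao_eq`). [cite: LemarieRieusset2016, Thm. 7.2 and Prop. 12.3] -/
theorem exists_isTaoSolutionOn_of_lerayHopf_classical (hν : 0 < ν) (hT : 0 < T)
    (hcl : IsClassicalNSSolutionOn (Ico 0 T) ν 0 u p) (hLH : IsLerayHopfOn T ν 0 (u 0) u)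
    (hdec : HasRapidSpatialDecay (u 0)) {t : ℝ} (ht0 : 0 < t) (htT : t < T) :
    ∃ (U : ℝ → (EuclideanSpace ℝ (Fin 3)) → (EuclideanSpace ℝ (Fin 3))) (P : ℝ → (EuclideanSpace ℝ (Fin 3)) → ℝ), IsTaoSolutionOn t ν (u 0) U P ∧
      ∀ s ∈ Icc 0 t, U s = u s := by
  have h0T : (0 : ℝ) ∈ Ico 0 T := ⟨le_rfl, hT⟩
  have hsm : ContDiff ℝ ∞ (u 0) := hcl.contDiff_velocity h0T
  have hdiv : VectorCalculus.IsDivFree (u 0) := hcl.divFree 0 h0T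
  have hdivW : NSWave0.IsDivFree (u 0) := fun x => hdiv x
  have hK : IsKatoSolutionOn T ν (u 0) u := isKatoSolutionOn_of_classical hν hT hcl hLH hdec
  obtain ⟨U, P, hU⟩ := exists_isTaoSolutionOn_of_isKatoSolutionOn hν hsm hdivW hdec hK ht0 htT
  exact ⟨U, P, hU, amplificationOf_tao_eq hν hcl hLH ht0 htT hU⟩

/-- **If the swirl of a classical Leray–Hopf solution from a rapidly decaying axisymmetric datum
vanishes identically at some time `t₀ ∈ [0, T)`, the solution extends smoothly past `T`.**
Take the Tao-class development `(U, P)` of `u 0` on `[0, t₁]`, `t₁ = (t₀ + T)/2` (`U = u`); its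
restart datum `U t₀ = u t₀` is smooth, divergence free, in `H^∞`, axisymmetric
(`IsTaoSolutionOn.isAxisymmetric`) and swirl-free, so ns.S24 in Tao's class
(`exists_isTaoSolutionOn_of_noSwirl`, fed with the discharged `tao2011_smooth_local_existence_holds`
and `axisymmetricNoSwirl_enstrophy_apriori_holds`) gives a Tao-class solution from it on
`[0, T - t₀ + 1]`; gluing (`IsTaoSolutionOn.glue`) yields a Tao-class solution from `u 0` on
`[0, T + 1]`, which agrees with `u` on `[0, T)` by weak–strong uniqueness (`amplificationOf_tao_eq`)
and is the required classical extension. [cite: LemarieRieusset2016, Thm 10.4 (p. 285)] -/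
theorem hasSmoothExtensionPast_of_hasNoSwirl_slice (hν : 0 < ν) (hT : 0 < T)
    (hcl : IsClassicalNSSolutionOn (Ico 0 T) ν 0 u p) (hLH : IsLerayHopfOn T ν 0 (u 0) u)
    (hdec : HasRapidSpatialDecay (u 0)) (haxi : IsAxisymmetric (u 0))
    {t₀ : ℝ} (ht₀ : t₀ ∈ Ico 0 T) (hsw : HasNoSwirl (u t₀)) : HasSmoothExtensionPast ν 0 u T := by
  -- the Tao-class development on `[0, t₁]`, `t₀ < t₁ < T`
  set t₁ : ℝ := (t₀ + T) / 2 with ht₁_def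
  have ht₀t₁ : t₀ < t₁ := by rw [ht₁_def]; linarith [ht₀.2]
  have ht₁T : t₁ < T := by rw [ht₁_def]; linarith [ht₀.2]
  have ht₁0 : 0 < t₁ := lt_of_le_of_lt ht₀.1 ht₀t₁
  obtain ⟨U, P, hU, hUeq⟩ := exists_isTaoSolutionOn_of_lerayHopf_classical hν hT hcl hLH hdec ht₁0 ht₁T
  have ht₀I : t₀ ∈ Icc 0 t₁ := ⟨ht₀.1, ht₀t₁.le⟩
  -- the restart datum `U t₀ = u t₀`
  have hUt₀ : U t₀ = u t₀ := hUeq t₀ ht₀I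
  have hsm : ContDiff ℝ ∞ (U t₀) := hU.classical.contDiff_velocity ht₀I
  have hdiv : VectorCalculus.IsDivFree (U t₀) := hU.classical.divFree t₀ ht₀I
  have hH : ∀ n : ℕ, ∫⁻ x, ‖iteratedFDeriv ℝ n (U t₀) x‖ₑ ^ 2 < ⊤ := fun n => by
    obtain ⟨C, hC⟩ := hU.sobolev n
    exact (hC t₀ ht₀I).trans_lt ENNReal.coe_lt_top
  have hax₀ : IsAxisymmetric (U t₀) := hU.isAxisymmetric hν ht₁0 haxi t₀ ht₀I
  have hsw₀ : HasNoSwirl (U t₀) := by rw [hUt₀]; exact hsw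
  -- ns.S24 in Tao's class: a Tao-class solution from `U t₀` on `[0, T - t₀ + 1]`
  have hS : 0 < T - t₀ + 1 := by linarith [ht₀.2]
  obtain ⟨W, Q, hW⟩ := exists_isTaoSolutionOn_of_noSwirl tao2011_smooth_local_existence_holds
    axisymmetricNoSwirl_enstrophy_apriori_holds hν hsm hdiv hH hax₀ hsw₀ hS
  -- glue at `a = t₀`: a Tao-class solution from `u 0` on `[0, t₀ + (T - t₀ + 1)] = [0, T + 1]`
  have hG := hU.glue hW hν hS ht₀.1 ht₀t₁ (by linarith)
  have hTT : T < t₀ + (T - t₀ + 1) := by linarith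
  refine ⟨t₀ + (T - t₀ + 1), hTT, _, _,
    hG.classical.mono Ico_subset_Icc_self (uniqueDiffOn_Ico _ _), fun t ht => ?_⟩
  -- agreement with `u` on `[0, T)`: restrict to `[0, t']`, `t ≤ t' < T`, and use uniqueness
  set t' : ℝ := (t + T) / 2 with ht'_def
  have htt' : t ≤ t' := by rw [ht'_def]; linarith [ht.2]
  have ht'T : t' < T := by rw [ht'_def]; linarith [ht.2]
  have ht'0 : 0 < t' := by rw [ht'_def]; linarith [ht.1, ht.2, hT]
  exact amplificationOf_tao_eq hν hcl hLH ht'0 ht'T (hG.mono ht'0 (by linarith)) t ⟨ht.1, htt'⟩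

/-- **The swirl of a witness vanishes identically at no time before the blow-up.** For a maximal
Leray–Hopf classical solution of finite lifespan `T` from a rapidly decaying axisymmetric datum,
`Γ(t) = r u_θ(t) ≢ 0` for EVERY `t ∈ [0, T)` ("the swirl cannot be used up before the singularity";
sharpens `not_hasNoSwirl_of_isMaximalSmoothSolution`, which is the case `t = 0`).
[cite: LemarieRieusset2016, Thm 10.4 (p. 285)] -/
theorem not_hasNoSwirl_slice_of_isMaximalSmoothSolution (hν : 0 < ν) (hT : 0 < T)
    (hmax : IsMaximalSmoothSolution ν 0 u p T) (hLH : IsLerayHopfOn T ν 0 (u 0) u)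
    (hdec : HasRapidSpatialDecay (u 0)) (haxi : IsAxisymmetric (u 0)) :
    ∀ t ∈ Ico 0 T, ¬ HasNoSwirl (u t) := fun _ ht hsw =>
  hmax.2 (hasSmoothExtensionPast_of_hasNoSwirl_slice hν hT hmax.1 hLH hdec haxi ht hsw)

/-- Pointwise form: at every time before the blow-up some point carries non-zero swirl. [folklore] -/
theorem exists_swirl_ne_zero_of_isMaximalSmoothSolution (hν : 0 < ν) (hT : 0 < T)
    (hmax : IsMaximalSmoothSolution ν 0 u p T) (hLH : IsLerayHopfOn T ν 0 (u 0) u)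
    (hdec : HasRapidSpatialDecay (u 0)) (haxi : IsAxisymmetric (u 0)) :
    ∀ t ∈ Ico 0 T, ∃ x, swirl (u t) x ≠ 0 := by
  intro t ht
  by_contra h
  push Not at h
  exact not_hasNoSwirl_slice_of_isMaximalSmoothSolution hν hT hmax hLH hdec haxi t ht h

/-- **Threshold structure (T1) of route `SwirlThreshold`, unconditional for witnesses: the swirl
supremum is strictly decreasing on the whole of `[0, T)`.** For `0 ≤ s < t < T` there is `y` with
`|Γ(t, x)| < |Γ(s, y)|` for all `x` — the route's proved support `SwirlSupStrictDecrease_proof`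
(stmt-NavierStokesRegularity-2004; weak and strong maximum principles for the swirl equation,
Lei–Zhang 2017 (1.4), KNSS 2009 Lemma 2.1), whose non-vanishing hypothesis `Γ(s) ≢ 0` always holds
along a witness by `exists_swirl_ne_zero_of_isMaximalSmoothSolution`. [cite: LeiZhang2017, (1.4)] -/
theorem swirlSup_strictAnti_of_isMaximalSmoothSolution (hν : 0 < ν) (hT : 0 < T)
    (hmax : IsMaximalSmoothSolution ν 0 u p T) (hLH : IsLerayHopfOn T ν 0 (u 0) u)
    (hdec : HasRapidSpatialDecay (u 0)) (haxi : IsAxisymmetric (u 0)) :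
    ∀ s t : ℝ, 0 ≤ s → s < t → t < T → ∃ y, ∀ x, |swirl (u t) x| < |swirl (u s) y| :=
  fun s t hs hst htT =>
    SwirlSupStrictDecrease_proof ν T hν hT u p hmax.1 hLH hdec haxi s t hs hst htT
      (exists_swirl_ne_zero_of_isMaximalSmoothSolution hν hT hmax hLH hdec haxi s ⟨hs, hst.trans htT⟩)

end Witness

/-! ### The crux, profiled -/

/-- **`CertifiedBlowupAxisymBlowup` is equivalent to its strengthening by the necessary structure of
a witness**: every slice before the lifespan axisymmetric WITH swirl, Type II at `T`, and no axis
bound `r|u| ≤ C`. [cite: KochNadirashviliSereginSverak2009, Thms 6.1–6.2] -/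
theorem certifiedBlowupAxisymBlowup_iff_exists_typeII_swirling :
    Summit.NavierStokesRegularity.NavierStokesRegularity.Theses.CertifiedBlowup.CertifiedBlowupAxisymBlowup ↔
      ∃ ν : ℝ, 0 < ν ∧ ∃ T : ℝ, 0 < T ∧
        ∃ (u : ℝ → EuclideanSpace ℝ (Fin 3) → EuclideanSpace ℝ (Fin 3))
          (p : ℝ → EuclideanSpace ℝ (Fin 3) → ℝ),
          IsMaximalSmoothSolution ν 0 u p T ∧ IsLerayHopfOn T ν 0 (u 0) u ∧
            HasRapidSpatialDecay (u 0) ∧ IsAxisymmetric (u 0) ∧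
            (∀ t ∈ Set.Ico 0 T, IsAxisymmetric (u t) ∧ ¬ HasNoSwirl (u t)) ∧
            ¬ IsTypeIBlowup u T ∧ ¬ ∃ C : ℝ, ∀ t ∈ Set.Ico 0 T, ∀ x, cylRadius x * ‖u t x‖ ≤ C := by
  constructor
  · rintro ⟨ν, hν, T, hT, u, p, hmax, hLH, hdec, hax⟩
    exact ⟨ν, hν, T, hT, u, p, hmax, hLH, hdec, hax,
      fun t ht => ⟨isAxisymmetric_slice_of_lerayHopf_classical hν hmax.1 hLH hdec hax t ht,
        not_hasNoSwirl_slice_of_isMaximalSmoothSolution hν hT hmax hLH hdec hax t ht⟩,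
      not_isTypeIBlowup_of_isMaximalSmoothSolution hν hT hmax hLH hdec hax,
      not_axisBound_of_isMaximalSmoothSolution hν hT hmax hLH hdec hax⟩
  · rintro ⟨ν, hν, T, hT, u, p, hmax, hLH, hdec, hax, -, -, -⟩
    exact ⟨ν, hν, T, hT, u, p, hmax, hLH, hdec, hax⟩

/-- Route `SwirlThreshold` spells the shared crux as `AxisymBlowup`; the two decls are the same
proposition. [folklore] -/
theorem axisymBlowup_iff_certifiedBlowupAxisymBlowup :
    Summit.NavierStokesRegularity.NavierStokesRegularity.Theses.SwirlThreshold.AxisymBlowup ↔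
      CertifiedBlowupAxisymBlowup :=
  Iff.rfl

/-- **The `SwirlThreshold` form of the profiled crux** (`AxisymBlowup`, rank-4 crux of route
`SwirlThreshold`): a witness is necessarily axisymmetric with swirl at all times before the
lifespan, Type II, and without axis bound. [cite: KochNadirashviliSereginSverak2009, Thms 6.1–6.2] -/
theorem axisymBlowup_iff_exists_typeII_swirling :
    Summit.NavierStokesRegularity.NavierStokesRegularity.Theses.SwirlThreshold.AxisymBlowup ↔
      ∃ ν : ℝ, 0 < ν ∧ ∃ T : ℝ, 0 < T ∧
        ∃ (u : ℝ → EuclideanSpace ℝ (Fin 3) → EuclideanSpace ℝ (Fin 3))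
          (p : ℝ → EuclideanSpace ℝ (Fin 3) → ℝ),
          IsMaximalSmoothSolution ν 0 u p T ∧ IsLerayHopfOn T ν 0 (u 0) u ∧
            HasRapidSpatialDecay (u 0) ∧ IsAxisymmetric (u 0) ∧
            (∀ t ∈ Set.Ico 0 T, IsAxisymmetric (u t) ∧ ¬ HasNoSwirl (u t)) ∧
            ¬ IsTypeIBlowup u T ∧ ¬ ∃ C : ℝ, ∀ t ∈ Set.Ico 0 T, ∀ x, cylRadius x * ‖u t x‖ ≤ C :=
  certifiedBlowupAxisymBlowup_iff_exists_typeII_swirling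

end Summit.NavierStokesRegularity.NavierStokesRegularity.Theorems.CertifiedBlowupAxisymBlowup.CompactAmplification

end
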